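import Literature.Probability.Percolation.FiniteClustersPercolationOneArm
import HarnessLib

/-!
# Crux `PercBurnResprinkle.VacantSetPercolates` (stmt-CriticalPhenomena-7205), line `planar-armed-sections` — stub `stub_coarsePercolates`

Helper file for the crux skeleton of the line `planar-armed-sections` (lead
prover-line-stmt-CriticalPhenomena-7205-0).  Proves exactly the registered stub signature; lands with
`--supports stmt-CriticalPhenomena-7205`.

The probabilistic half of the static planar renormalisation.  The coarse bond configuration
`BC n N ω` on `ℤ²` (the edge `{a, a + e_k}` is open iff the long-way quiet crossing of the block
rectangle of `a` in direction `k` and the two transverse crossings at `a` and `a + e_k` occur) is,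
under `P_p`, a `5`-dependent bond process on `ℤ²` (hypothesis FOOTPRINT: the edge events have finite
footprints, disjoint for coarse pairs at sup-distance `≥ 5`, plus `bondPercolation_inter_of_disjoint`)
whose edges are open with probability `≥ 1 - 3 η₀` (union bound over the three crossing events, each
of probability equal to an origin crossing probability by hypothesis SHIFT, measurable by hypothesis
LOCALITY).  With `3 η₀ = η(5)`, the constant of the tree's PROVED dependent-percolation input
`DuminilCopinSidoraviciusTassion2016_dependentPercolation_holds 5`, the push-forward measure
percolates from the coarse origin.  The argument is the one of
`Literature.Probability.Percolation.exists_eta_finiteClustersPercolateAt_pos` (segments replaced by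
rectangle crossings), written for an abstract coarse map `Φ` and an abstract family of crossing
events `Q a k` so that the registered (unfolded) objects are met by instantiation.
No definitions; helper lemmas in the sub-namespace `CoarsePercolates`.
-/

noncomputable section

namespace Summit.CriticalPhenomena.PercolationContinuityZ3.Theorems

open MeasureTheory Set Literature.Probability.Percolation Literature.Probability.LatticeModels

namespace CoarsePercolates

/-! ### Locality tools -/

/-- An event determined by a finite set of pairs is measurable. [folklore] -/
theorem measurableSet_of_determinedBy_finite {ι : Type*} {A : Set (Set ι)} {S : Set ι}
    (h : DeterminedBy A S) (hS : S.Finite) : MeasurableSet A := by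
  rw [← hS.coe_toFinset] at h
  exact h.measurableSet_of_finset

/-- Pull-backs, under a coarse map `Φ` whose edge events `{ω | e ∈ Φ ω}` are determined by the
footprints `FPT e`, of events determined by `F` are determined by `⋃ e ∈ F, FPT e`.
[cite: GrimmettHolroydKozma2014, §4] -/
theorem determinedBy_preimage {Φ : BondConfig (Site 3) → BondConfig (Site 2)}
    {FPT : Sym2 (Site 2) → Set (Sym2 (Site 3))}
    (hFPT : ∀ e, DeterminedBy {ω | e ∈ Φ ω} (FPT e)) {A : Set (BondConfig (Site 2))}
    {F : Finset (Sym2 (Site 2))} (hA : DeterminedBy A ↑F) :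
    DeterminedBy (Φ ⁻¹' A) (⋃ e ∈ F, FPT e) := by
  rw [determinedBy_iff] at hA ⊢
  intro ω ω' h
  simp only [mem_preimage]
  refine hA _ _ (Set.ext fun e => ?_)
  simp only [mem_inter_iff, Finset.mem_coe]
  exact and_congr_left fun he => (determinedBy_iff _ _).1 (hFPT e) ω ω'
    (inter_eq_inter_of_subset h (subset_iUnion₂ (s := fun e (_ : e ∈ F) => FPT e) e he))

/-- Footprints of two families of coarse pairs at mutual sup-distance `≥ 5` are disjoint.
[folklore] -/
theorem disjoint_biUnion {FPT : Sym2 (Site 2) → Set (Sym2 (Site 3))}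
    (hdisj : ∀ e₁ e₂ : Sym2 (Site 2),
      (∀ b₁ ∈ e₁, ∀ b₂ ∈ e₂, ((5 : ℕ) : ℤ) ≤ max |b₁ 0 - b₂ 0| |b₁ 1 - b₂ 1|) →
        Disjoint (FPT e₁) (FPT e₂))
    {F₁ F₂ : Finset (Sym2 (Site 2))}
    (hsep : ∀ e₁ ∈ F₁, ∀ e₂ ∈ F₂, ∀ a ∈ e₁, ∀ b ∈ e₂,
      ((5 : ℕ) : ℤ) ≤ max |a 0 - b 0| |a 1 - b 1|) :
    Disjoint (⋃ e ∈ F₁, FPT e) (⋃ e ∈ F₂, FPT e) :=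
  Set.disjoint_iUnion₂_left.2 fun e₁ he₁ => Set.disjoint_iUnion₂_right.2 fun e₂ he₂ =>
    hdisj e₁ e₂ (hsep e₁ he₁ e₂ he₂)

/-! ### The abstract renormalisation step -/

/-- **Dependent percolation of a coarse process.** If the edge events of a coarse map
`Φ : {configurations on ℤ³} → {configurations on ℤ²}` have finite footprints, disjoint for coarse
pairs at sup-distance `≥ 5`, then the push-forward of `P_p` under `Φ` is a `5`-dependent bond
measure on `ℤ²` (`bondPercolation_inter_of_disjoint`); if moreover every lattice edge of `ℤ²` is
`Φ`-open with probability `≥ 1 - η`, `η` the dependent-percolation constant at range `5`, then the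
coarse origin percolates with positive probability.
[cite: GrimmettHolroydKozma2014, §4 (proof of Thm. 5, block argument)] -/
theorem pos_of_dependent (p : unitInterval) {Φ : BondConfig (Site 3) → BondConfig (Site 2)}
    {FPT : Sym2 (Site 2) → Set (Sym2 (Site 3))}
    (hFPT : ∀ e, DeterminedBy {ω | e ∈ Φ ω} (FPT e) ∧ (FPT e).Finite)
    (hdisj : ∀ e₁ e₂ : Sym2 (Site 2),
      (∀ b₁ ∈ e₁, ∀ b₂ ∈ e₂, ((5 : ℕ) : ℤ) ≤ max |b₁ 0 - b₂ 0| |b₁ 1 - b₂ 1|) →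
        Disjoint (FPT e₁) (FPT e₂))
    {η : ℝ}
    (hD : ∀ (μ : Measure (BondConfig (Site 2))) [IsProbabilityMeasure μ],
      (∀ (F₁ F₂ : Finset (Sym2 (Site 2))),
        (∀ e₁ ∈ F₁, ∀ e₂ ∈ F₂, ∀ a ∈ e₁, ∀ b ∈ e₂,
          ((5 : ℕ) : ℤ) ≤ max |a 0 - b 0| |a 1 - b 1|) →
        ∀ (A B : Set (BondConfig (Site 2))), DeterminedBy A (↑F₁ : Set (Sym2 (Site 2))) →
          DeterminedBy B (↑F₂ : Set (Sym2 (Site 2))) → MeasurableSet A → MeasurableSet B →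
          μ (A ∩ B) = μ A * μ B) →
      (∀ e ∈ (zdGraph 2).edgeSet, 1 - η ≤ μ.real {ω | e ∈ ω}) →
      0 < μ.real (percolatesAt (0 : Site 2)))
    (hmarg : ∀ e ∈ (zdGraph 2).edgeSet,
      1 - η ≤ (bondPercolation (zdGraph 3) p).real {ω | e ∈ Φ ω}) :
    0 < (bondPercolation (zdGraph 3) p).real {ω | (openCluster (Φ ω) (0 : Site 2)).Infinite} := by
  set P := bondPercolation (zdGraph 3) p with hP
  have hmeas : ∀ e, MeasurableSet {ω | e ∈ Φ ω} := fun e =>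
    measurableSet_of_determinedBy_finite (hFPT e).1 (hFPT e).2
  have hΦ : Measurable Φ := measurable_set_iff.2 fun e => measurableSet_setOf.1 (hmeas e)
  set μ : Measure (BondConfig (Site 2)) := P.map Φ with hμ
  haveI : IsProbabilityMeasure μ := Measure.isProbabilityMeasure_map hΦ.aemeasurable
  -- finite dependence at range 5
  have hdep : ∀ F₁ F₂ : Finset (Sym2 (Site 2)),
      (∀ e₁ ∈ F₁, ∀ e₂ ∈ F₂, ∀ a ∈ e₁, ∀ b ∈ e₂,
        ((5 : ℕ) : ℤ) ≤ max |a 0 - b 0| |a 1 - b 1|) →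
      ∀ A B : Set (BondConfig (Site 2)), DeterminedBy A (↑F₁ : Set (Sym2 (Site 2))) →
        DeterminedBy B (↑F₂ : Set (Sym2 (Site 2))) → MeasurableSet A → MeasurableSet B →
        μ (A ∩ B) = μ A * μ B := by
    intro F₁ F₂ hsep A B hA hB hAm hBm
    rw [hμ, Measure.map_apply hΦ (hAm.inter hBm), Measure.map_apply hΦ hAm,
      Measure.map_apply hΦ hBm, preimage_inter]
    exact bondPercolation_inter_of_disjoint (zdGraph 3) p (disjoint_biUnion hdisj hsep)
      (determinedBy_preimage (fun e => (hFPT e).1) hA)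
      (determinedBy_preimage (fun e => (hFPT e).1) hB) (hΦ hAm) (hΦ hBm)
  -- densities of the coarse edges
  have hmarg' : ∀ e ∈ (zdGraph 2).edgeSet, 1 - η ≤ μ.real {ω | e ∈ ω} := by
    intro e he
    rw [hμ, map_measureReal_apply hΦ (measurableSet_mem e)]
    exact hmarg e he
  have hpos := hD μ hdep hmarg'
  rw [hμ, map_measureReal_apply hΦ (measurableSet_percolatesAt_holds (0 : Site 2))] at hpos
  exact hpos

/-! ### The density of the coarse edges -/

/-- The other index of `Fin 2`. [folklore] -/
theorem exists_other : ∀ k : Fin 2, ∃ j₀ : Fin 2, j₀ ≠ k ∧ ∀ j : Fin 2, j ≠ k → j = j₀ := by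
  decide

/-- Union bound: three events of probability `≥ 1 - η₀` occur together with probability
`≥ 1 - 3 η₀`. [folklore] -/
theorem real_inter₃_ge {Ω : Type*} [MeasurableSpace Ω] (P : Measure Ω) [IsProbabilityMeasure P]
    {A B C : Set Ω} (hA : MeasurableSet A) (hB : MeasurableSet B) (hC : MeasurableSet C)
    {η₀ : ℝ} (ha : 1 - η₀ ≤ P.real A) (hb : 1 - η₀ ≤ P.real B) (hc : 1 - η₀ ≤ P.real C) :
    1 - 3 * η₀ ≤ P.real (A ∩ B ∩ C) := by
  have h1 : P.real (A ∩ B ∩ C)ᶜ ≤ P.real Aᶜ + P.real Bᶜ + P.real Cᶜ := by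
    rw [compl_inter, compl_inter]
    exact (measureReal_union_le _ _).trans (add_le_add (measureReal_union_le _ _) le_rfl)
  rw [measureReal_compl ((hA.inter hB).inter hC), measureReal_compl hA, measureReal_compl hB,
    measureReal_compl hC, probReal_univ] at h1
  linarith

/-- A coarse lattice edge `{a, a + e_k}` is open as soon as its three crossing events (the
long-way crossing at `a` in direction `k` and the two transverse ones, in the other direction `j₀`,
at `a` and at `a + e_k`) occur. [folklore] -/
theorem inter₃_subset (Q : Site 2 → Fin 2 → BondConfig (Site 3) → Prop) (a : Site 2)
    {k j₀ : Fin 2} (hj₀ : ∀ j : Fin 2, j ≠ k → j = j₀) :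
    {ω | Q a k ω} ∩ {ω | Q a j₀ ω} ∩ {ω | Q (a + Pi.single k 1) j₀ ω} ⊆
      {ω | s(a, a + Pi.single k 1) ∈ {e : Sym2 (Site 2) | ∃ (b : Site 2) (i : Fin 2),
        e = s(b, b + Pi.single i 1) ∧ Q b i ω ∧
          ∀ j : Fin 2, j ≠ i → Q b j ω ∧ Q (b + Pi.single i 1) j ω}} := by
  rintro ω ⟨⟨h1, h2⟩, h3⟩
  refine ⟨a, k, rfl, h1, fun j hj => ?_⟩
  obtain rfl := hj₀ j hj
  exact ⟨h2, h3⟩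

/-- **Density of the coarse edges.** If every crossing event `Q a k` is measurable and has
probability `≥ 1 - η₀`, then every lattice edge `e = {a, a + e_k}` of `ℤ²` is open in the coarse
configuration `{e | ∃ a k, e = {a, a + e_k} ∧ Q a k ∧ ∀ j ≠ k, Q a j ∧ Q (a + e_k) j}` with
probability `≥ 1 - 3 η₀` (union bound over the three crossing events of `e`).
[cite: GrimmettHolroydKozma2014, §4 (proof of Thm. 5, (K1))] -/
theorem marginal (P : Measure (BondConfig (Site 3))) [IsProbabilityMeasure P]
    (Q : Site 2 → Fin 2 → BondConfig (Site 3) → Prop) (hQm : ∀ a k, MeasurableSet {ω | Q a k ω})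
    {η₀ : ℝ} (hQ : ∀ a k, 1 - η₀ ≤ P.real {ω | Q a k ω}) {e : Sym2 (Site 2)}
    (he : e ∈ (zdGraph 2).edgeSet) :
    1 - 3 * η₀ ≤ P.real {ω | e ∈ {e : Sym2 (Site 2) | ∃ (a : Site 2) (k : Fin 2),
        e = s(a, a + Pi.single k 1) ∧ Q a k ω ∧
          ∀ j : Fin 2, j ≠ k → Q a j ω ∧ Q (a + Pi.single k 1) j ω}} := by
  obtain ⟨a, k, rfl⟩ : ∃ (a : Site 2) (k : Fin 2), e = s(a, a + Pi.single k 1) := by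
    induction e using Sym2.ind with
    | _ x y =>
      rw [SimpleGraph.mem_edgeSet, zdGraph_adj_iff] at he
      obtain ⟨i, h | h⟩ := he
      · exact ⟨x, i, by rw [h]⟩
      · exact ⟨y, i, by rw [h, Sym2.eq_swap]⟩
  obtain ⟨j₀, -, hj₀⟩ := exists_other k
  exact (real_inter₃_ge P (hQm a k) (hQm a j₀) (hQm _ j₀) (hQ a k) (hQ a j₀) (hQ _ j₀)).trans
    (measureReal_mono (inter₃_subset Q a hj₀) (measure_ne_top _ _))

end CoarsePercolates

/-- **Registered stub `stub_coarsePercolates`** (line `planar-armed-sections` of the crux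
`VacantSetPercolates`): LOCALITY → SHIFT → FOOTPRINT → the coarse process of quiet rectangle
crossings percolates from the coarse origin with positive probability as soon as the two origin
crossing probabilities are `≥ 1 - η₀`, for a universal `η₀ > 0` (a third of the dependent-percolation
constant of `ℤ²` at range `5`).  Finitely dependent planar renormalisation: the push-forward of `P_p`
under the coarse map is `5`-dependent with edge densities `≥ 1 - 3 η₀`, and
`DuminilCopinSidoraviciusTassion2016_dependentPercolation_holds 5` applies.
[cite: GrimmettHolroydKozma2014, §4 (proof of Thm. 5, block argument)] -/
theorem stub_coarsePercolates :
    (∀ (n N : ℕ) (a : Site 2) (k : Fin 2),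
      DeterminedBy
        {ω : BondConfig (Site 3) | ∃ x y : Site 2, x k = (N : ℤ) * a k ∧ y k = (N : ℤ) * a k + 2 * (N : ℤ) ∧
          PathIn (zdGraph 2) ({w : Site 2 | ((N : ℤ) * a k ≤ w k ∧ w k ≤ (N : ℤ) * a k + 2 * (N : ℤ)) ∧
            ∀ j : Fin 2, j ≠ k → (N : ℤ) * a j ≤ w j ∧ w j ≤ (N : ℤ) * a j + (N : ℤ)} ∩
            {w | planeEmb 3 w ∈ quietSet n ω}) x y}
        (⋃ w ∈ {w : Site 2 | ((N : ℤ) * a k ≤ w k ∧ w k ≤ (N : ℤ) * a k + 2 * (N : ℤ)) ∧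
            ∀ j : Fin 2, j ≠ k → (N : ℤ) * a j ≤ w j ∧ w j ≤ (N : ℤ) * a j + (N : ℤ)},
          armPairs (planeEmb 3 w) n) ∧
      (⋃ w ∈ {w : Site 2 | ((N : ℤ) * a k ≤ w k ∧ w k ≤ (N : ℤ) * a k + 2 * (N : ℤ)) ∧
            ∀ j : Fin 2, j ≠ k → (N : ℤ) * a j ≤ w j ∧ w j ≤ (N : ℤ) * a j + (N : ℤ)},
          armPairs (planeEmb 3 w) n).Finite) →
    (∀ (p : unitInterval) (n N : ℕ) (a : Site 2) (k : Fin 2),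
      (bondPercolation (zdGraph 3) p).real
        {ω | ∃ x y : Site 2, x k = (N : ℤ) * a k ∧ y k = (N : ℤ) * a k + 2 * (N : ℤ) ∧
          PathIn (zdGraph 2) ({w : Site 2 | ((N : ℤ) * a k ≤ w k ∧ w k ≤ (N : ℤ) * a k + 2 * (N : ℤ)) ∧
            ∀ j : Fin 2, j ≠ k → (N : ℤ) * a j ≤ w j ∧ w j ≤ (N : ℤ) * a j + (N : ℤ)} ∩
            {w | planeEmb 3 w ∈ quietSet n ω}) x y} =
      (bondPercolation (zdGraph 3) p).real
        {ω | ∃ x y : Site 2, x k = 0 ∧ y k = 2 * (N : ℤ) ∧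
          PathIn (zdGraph 2) ({w : Site 2 | (0 ≤ w k ∧ w k ≤ 2 * (N : ℤ)) ∧
            ∀ j : Fin 2, j ≠ k → 0 ≤ w j ∧ w j ≤ (N : ℤ)} ∩ {w | planeEmb 3 w ∈ quietSet n ω}) x y}) →
    (∀ (n N : ℕ), 2 * n < N → ∃ FPT : Sym2 (Site 2) → Set (Sym2 (Site 3)),
      (∀ e : Sym2 (Site 2), DeterminedBy {ω : BondConfig (Site 3) | e ∈
        {e : Sym2 (Site 2) | ∃ (a : Site 2) (k : Fin 2), e = s(a, a + Pi.single k 1) ∧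
          (∃ x y : Site 2, x k = (N : ℤ) * a k ∧ y k = (N : ℤ) * a k + 2 * (N : ℤ) ∧
            PathIn (zdGraph 2) ({w : Site 2 | ((N : ℤ) * a k ≤ w k ∧ w k ≤ (N : ℤ) * a k + 2 * (N : ℤ)) ∧
              ∀ j : Fin 2, j ≠ k → (N : ℤ) * a j ≤ w j ∧ w j ≤ (N : ℤ) * a j + (N : ℤ)} ∩
              {w | planeEmb 3 w ∈ quietSet n ω}) x y) ∧
          ∀ j : Fin 2, j ≠ k →
            (∃ x y : Site 2, x j = (N : ℤ) * a j ∧ y j = (N : ℤ) * a j + 2 * (N : ℤ) ∧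
              PathIn (zdGraph 2) ({w : Site 2 | ((N : ℤ) * a j ≤ w j ∧ w j ≤ (N : ℤ) * a j + 2 * (N : ℤ)) ∧
                ∀ i : Fin 2, i ≠ j → (N : ℤ) * a i ≤ w i ∧ w i ≤ (N : ℤ) * a i + (N : ℤ)} ∩
                {w | planeEmb 3 w ∈ quietSet n ω}) x y) ∧
            (∃ x y : Site 2, x j = (N : ℤ) * (a + Pi.single k 1 : Site 2) j ∧ y j = (N : ℤ) * (a + Pi.single k 1 : Site 2) j + 2 * (N : ℤ) ∧
              PathIn (zdGraph 2) ({w : Site 2 | ((N : ℤ) * (a + Pi.single k 1 : Site 2) j ≤ w j ∧ w j ≤ (N : ℤ) * (a + Pi.single k 1 : Site 2) j + 2 * (N : ℤ)) ∧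
                ∀ i : Fin 2, i ≠ j → (N : ℤ) * (a + Pi.single k 1 : Site 2) i ≤ w i ∧ w i ≤ (N : ℤ) * (a + Pi.single k 1 : Site 2) i + (N : ℤ)} ∩
                {w | planeEmb 3 w ∈ quietSet n ω}) x y)}} (FPT e) ∧ (FPT e).Finite) ∧
      ∀ e₁ e₂ : Sym2 (Site 2), (∀ b₁ ∈ e₁, ∀ b₂ ∈ e₂, ((5 : ℕ) : ℤ) ≤ max |b₁ 0 - b₂ 0| |b₁ 1 - b₂ 1|) →
        Disjoint (FPT e₁) (FPT e₂)) →
    ∃ η₀ : ℝ, 0 < η₀ ∧ ∀ (p : unitInterval) (n N : ℕ), 1 ≤ n → 2 * n < N →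
      (∀ k : Fin 2, 1 - η₀ ≤ (bondPercolation (zdGraph 3) p).real
        {ω | ∃ x y : Site 2, x k = 0 ∧ y k = 2 * (N : ℤ) ∧
          PathIn (zdGraph 2) ({w : Site 2 | (0 ≤ w k ∧ w k ≤ 2 * (N : ℤ)) ∧
            ∀ j : Fin 2, j ≠ k → 0 ≤ w j ∧ w j ≤ (N : ℤ)} ∩ {w | planeEmb 3 w ∈ quietSet n ω}) x y}) →
      0 < (bondPercolation (zdGraph 3) p).real
        {ω | (openCluster
          {e : Sym2 (Site 2) | ∃ (a : Site 2) (k : Fin 2), e = s(a, a + Pi.single k 1) ∧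
            (∃ x y : Site 2, x k = (N : ℤ) * a k ∧ y k = (N : ℤ) * a k + 2 * (N : ℤ) ∧
              PathIn (zdGraph 2) ({w : Site 2 | ((N : ℤ) * a k ≤ w k ∧ w k ≤ (N : ℤ) * a k + 2 * (N : ℤ)) ∧
                ∀ j : Fin 2, j ≠ k → (N : ℤ) * a j ≤ w j ∧ w j ≤ (N : ℤ) * a j + (N : ℤ)} ∩
                {w | planeEmb 3 w ∈ quietSet n ω}) x y) ∧
            ∀ j : Fin 2, j ≠ k →
              (∃ x y : Site 2, x j = (N : ℤ) * a j ∧ y j = (N : ℤ) * a j + 2 * (N : ℤ) ∧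
                PathIn (zdGraph 2) ({w : Site 2 | ((N : ℤ) * a j ≤ w j ∧ w j ≤ (N : ℤ) * a j + 2 * (N : ℤ)) ∧
                  ∀ i : Fin 2, i ≠ j → (N : ℤ) * a i ≤ w i ∧ w i ≤ (N : ℤ) * a i + (N : ℤ)} ∩
                  {w | planeEmb 3 w ∈ quietSet n ω}) x y) ∧
              (∃ x y : Site 2, x j = (N : ℤ) * (a + Pi.single k 1 : Site 2) j ∧ y j = (N : ℤ) * (a + Pi.single k 1 : Site 2) j + 2 * (N : ℤ) ∧
                PathIn (zdGraph 2) ({w : Site 2 | ((N : ℤ) * (a + Pi.single k 1 : Site 2) j ≤ w j ∧ w j ≤ (N : ℤ) * (a + Pi.single k 1 : Site 2) j + 2 * (N : ℤ)) ∧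
                  ∀ i : Fin 2, i ≠ j → (N : ℤ) * (a + Pi.single k 1 : Site 2) i ≤ w i ∧ w i ≤ (N : ℤ) * (a + Pi.single k 1 : Site 2) i + (N : ℤ)} ∩
                  {w | planeEmb 3 w ∈ quietSet n ω}) x y)}
          (0 : Site 2)).Infinite} := by
  intro hLoc hShift hFoot
  obtain ⟨η, hη, hD⟩ := DuminilCopinSidoraviciusTassion2016_dependentPercolation_holds 5
  refine ⟨η / 3, by positivity, fun p n N _hn hN hdens => ?_⟩
  obtain ⟨FPT, hFPT, hdisj⟩ := hFoot n N hN
  have h3 : (1 : ℝ) - η = 1 - 3 * (η / 3) := by ring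
  refine CoarsePercolates.pos_of_dependent p hFPT hdisj hD fun e he => ?_
  exact h3.trans_le (CoarsePercolates.marginal (bondPercolation (zdGraph 3) p)
    (fun a k ω => ∃ x y : Site 2, x k = (N : ℤ) * a k ∧ y k = (N : ℤ) * a k + 2 * (N : ℤ) ∧
      PathIn (zdGraph 2) ({w : Site 2 | ((N : ℤ) * a k ≤ w k ∧ w k ≤ (N : ℤ) * a k + 2 * (N : ℤ)) ∧
        ∀ j : Fin 2, j ≠ k → (N : ℤ) * a j ≤ w j ∧ w j ≤ (N : ℤ) * a j + (N : ℤ)} ∩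
        {w | planeEmb 3 w ∈ quietSet n ω}) x y)
    (fun a k => CoarsePercolates.measurableSet_of_determinedBy_finite (hLoc n N a k).1
      (hLoc n N a k).2)
    (fun a k => (hdens k).trans_eq (hShift p n N a k).symm) he)

end Summit.CriticalPhenomena.PercolationContinuityZ3.Theorems

end
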